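import Summits.AtomisticToContinuum.Crystallization.Theses.DisclinationRation
import Mathlib.NumberTheory.ZetaValues
import Mathlib.Analysis.Real.Pi.Bounds
import Mathlib.Analysis.Normed.Ring.InfiniteSum

/-!
# `UniformPolytypeStability` (stmt-AtomisticToContinuum-15800), negative side IV-a: the compressed triangular Lennard-Jones membrane buckles

Part IV-a of the standing disprover's load-bearing analysis of crux `UniformPolytypeStability`
(route `DisclinationRation`).  A self-contained, purely two-dimensional estimate used by part IV-b
(`Negative/HeightUpper.lean`: the UPPER height bound `z(m+1) − z(m) ≤ 17a/20` is load-bearing).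
At the compressed edge `a₀ = 47/50` of the crux's window a single triangular layer
`Λ = ℤu + ℤv` (`|i u + j v|² = a₀²(i² + ij + j²)`) is a Lennard-Jones membrane under biaxial
COMPRESSION, and its out-of-plane ("flexural") single-site stiffness is the transverse row sum
`P = Σ_{η ∈ Λ∖0} V′(|η|)/|η| = Σ_{(i,j) ≠ 0} ψ(i² + ij + j²)`, `ψ(q) = −(a₀²q)⁻⁷ + (a₀²q)⁻⁴`
(`V(r) = r⁻¹²/12 − r⁻⁶/6`, `V′(r)/r = −r⁻¹⁴ + r⁻⁸`).  We prove `P < −3/2` (`tsum_ψpl_lt`;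
numerically `P = −4.261`): the six nearest neighbours give `6ψ(1) = −4.4249` exactly, and the
rest is `≥ 0` termwise and at most `2.597`, by the majorant `ψ(q) ≤ a₀⁻⁸q⁻⁴`, `q ≥ 3` on the
`5 × 5` block, and the strip bound `q⁻⁴ ≤ (256/81)·i⁻⁴·φ(j)` for `|i| ≥ 3` (`4q ≥ 3i², 3j²`)
summed with `Σ_{n≥1} n⁻⁴ = π⁴/90` (Mathlib `hasSum_zeta_four`, `π < 3.15`).  No lattice-sum
numerics enter.  All `[folklore]`.
-/

noncomputable section

namespace Summit.AtomisticToContinuum.Crystallization.Theorems.UniformPolytypeStabilityNegative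

open scoped BigOperators Topology Classical
open Filter Set Function Real

/-! ## §5 One-dimensional bookkeeping: `Σ_{n∈ℤ} φ(n) = 1 + 2ζ(4)`, `Σ_{|n|≥3} n⁻⁴ = 2(ζ(4) − 17/16)` -/

/-- Row weight of the strip majorant: `φ(n) = n⁻⁴` off the origin, `φ(0) = 1`. [folklore] -/
def φ4 (n : ℤ) : ℝ := if n = 0 then 1 else ((n : ℝ) ^ 4)⁻¹

/-- Column weight of the strip majorant: `t(n) = n⁻⁴` for `|n| ≥ 3`, else `0`. [folklore] -/
def t4 (n : ℤ) : ℝ := if 3 ≤ |n| then ((n : ℝ) ^ 4)⁻¹ else 0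

/-- `φ ≥ 0`. [folklore] -/
theorem φ4_nonneg (n : ℤ) : 0 ≤ φ4 n := by unfold φ4; split_ifs <;> positivity

/-- `t ≥ 0`. [folklore] -/
theorem t4_nonneg (n : ℤ) : 0 ≤ t4 n := by unfold t4; split_ifs <;> positivity

/-- `Σ_{n ∈ ℤ} φ(n) = 1 + 2·π⁴/90`. [folklore] -/
theorem hasSum_φ4 : HasSum φ4 (1 + 2 * (π ^ 4 / 90)) := by
  have hA : HasSum (fun n : ℕ => φ4 n) (π ^ 4 / 90 + 1) := by
    have h1 : (fun n : ℕ => φ4 n) = fun n : ℕ => 1 / (n : ℝ) ^ 4 + if n = 0 then 1 else 0 := by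
      funext n
      rcases eq_or_ne n 0 with rfl | hn
      · simp [φ4]
      · simp [φ4, hn, one_div]
    rw [h1]
    exact hasSum_zeta_four.add (hasSum_ite_eq 0 1)
  have hB : HasSum (fun n : ℕ => φ4 (-(n + 1 : ℤ))) (π ^ 4 / 90) := by
    have h := (hasSum_nat_add_iff' 1).2 hasSum_zeta_four
    simp only [Finset.sum_range_one, Nat.cast_zero, ne_eq, OfNat.ofNat_ne_zero,
      not_false_eq_true, zero_pow, div_zero, sub_zero] at h
    have he : (fun n : ℕ => φ4 (-(n + 1 : ℤ))) = fun n : ℕ => 1 / ((n + 1 : ℕ) : ℝ) ^ 4 := by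
      funext n
      have hne : (-(n + 1 : ℤ)) ≠ 0 := by omega
      simp only [φ4, hne, if_false, one_div]
      push_cast
      ring
    rw [he]
    exact h
  have := hA.of_nat_of_neg_add_one hB
  convert this using 1
  ring

/-- `Σ_{|n| ≥ 3} n⁻⁴ = 2(π⁴/90 − 17/16)`. [folklore] -/
theorem hasSum_t4 : HasSum t4 (2 * (π ^ 4 / 90 - 17 / 16)) := by
  have hT : HasSum (fun n : ℕ => t4 n) (π ^ 4 / 90 - 17 / 16) := by
    have h := (hasSum_nat_add_iff' 3).2 hasSum_zeta_four
    have hs : ∑ i ∈ Finset.range 3, (1 : ℝ) / (i : ℝ) ^ 4 = 17 / 16 := by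
      simp [Finset.sum_range_succ]; norm_num
    rw [hs] at h
    have h' : HasSum (fun n : ℕ => t4 ((n + 3 : ℕ) : ℤ)) (π ^ 4 / 90 - 17 / 16) := by
      have he : (fun n : ℕ => t4 ((n + 3 : ℕ) : ℤ)) = fun n : ℕ => 1 / ((n + 3 : ℕ) : ℝ) ^ 4 := by
        funext n
        have h3 : (3 : ℤ) ≤ |((n + 3 : ℕ) : ℤ)| := by
          rw [abs_of_nonneg (by positivity)]; push_cast; omega
        simp only [t4, h3, if_true, one_div]
        push_cast
        ring
      rw [he]
      exact h
    have h'' := (hasSum_nat_add_iff (f := fun n : ℕ => t4 n) 3).1 h'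
    have hz : ∑ i ∈ Finset.range 3, t4 (i : ℕ) = 0 := by
      simp [Finset.sum_range_succ, t4]
    simpa [hz] using h''
  have hB : HasSum (fun n : ℕ => t4 (-(n + 1 : ℤ))) (π ^ 4 / 90 - 17 / 16) := by
    have he : (fun n : ℕ => t4 (-(n + 1 : ℤ))) = fun n : ℕ => t4 ((n + 1 : ℕ) : ℤ) := by
      funext n
      simp only [t4, abs_neg, Nat.cast_add, Nat.cast_one, Int.cast_neg, Int.cast_add,
        Int.cast_natCast, Int.cast_one]
      congr 1
      ring
    rw [he]
    refine (hasSum_nat_add_iff (f := fun n : ℕ => t4 n) 1).2 ?_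
    simpa [t4] using hT
  have := hT.of_nat_of_neg_add_one hB
  convert this using 1
  ring

/-- `ζ(4) = π⁴/90 < 1.094` (from `π < 3.15`). [folklore] -/
theorem zeta_four_lt : π ^ 4 / 90 < 1094 / 1000 := by
  have hπ := Real.pi_lt_d2
  have h4 : π ^ 4 < (3.15 : ℝ) ^ 4 := by gcongr
  have : (3.15 : ℝ) ^ 4 < 98.46 := by norm_num
  linarith

/-- `Σ_{n∈ℤ} φ(n) ≤ 16/5`. [folklore] -/
theorem tsum_φ4_le : ∑' n, φ4 n ≤ 16 / 5 := by
  rw [hasSum_φ4.tsum_eq]; linarith [zeta_four_lt]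

/-- `Σ_{|n|≥3} n⁻⁴ ≤ 63/1000`. [folklore] -/
theorem tsum_t4_le : ∑' n, t4 n ≤ 63 / 1000 := by
  rw [hasSum_t4.tsum_eq]; linarith [zeta_four_lt]

/-- `‖t‖` is summable. [folklore] -/
theorem summable_norm_t4 : Summable fun n => ‖t4 n‖ := by
  simpa only [Real.norm_eq_abs] using hasSum_t4.summable.abs

/-- `‖φ‖` is summable. [folklore] -/
theorem summable_norm_φ4 : Summable fun n => ‖φ4 n‖ := by
  simpa only [Real.norm_eq_abs] using hasSum_φ4.summable.abs

/-! ## §6 The planar transverse row sum of the compressed triangular LJ membrane -/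

/-- In-layer spacing of the witness: the compressed edge `a₀ = 47/50` of the crux's window.
[folklore] -/
def a₀ : ℝ := 47 / 50

/-- The norm form of the triangular lattice: `|i u + j v|² = a²·(i² + ij + j²)`. [folklore] -/
def Qf (p : ℤ × ℤ) : ℤ := p.1 ^ 2 + p.1 * p.2 + p.2 ^ 2

/-- The transverse LJ row weight `V′(r)/r = −r⁻¹⁴ + r⁻⁸` at `r² = a₀²q`. [folklore] -/
def ψQ (q : ℝ) : ℝ := -((a₀ ^ 2 * q)⁻¹) ^ 7 + ((a₀ ^ 2 * q)⁻¹) ^ 4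

/-- The six nearest neighbours `±u, ±v, ±(u − v)` of the origin. [folklore] -/
def NN6 : Finset (ℤ × ℤ) := {(1, 0), (-1, 0), (0, 1), (0, -1), (1, -1), (-1, 1)}

/-- The planar row function `(i,j) ↦ V′(|η|)/|η|`, `η = i u + j v ≠ 0` (`0` at the origin).
[folklore] -/
def ψpl (p : ℤ × ℤ) : ℝ := if p = 0 then 0 else ψQ (Qf p)

/-- Its nearest-neighbour part. [folklore] -/
def ψNN (p : ℤ × ℤ) : ℝ := if p ∈ NN6 then ψQ 1 else 0

/-- Its far part (second neighbours and beyond). [folklore] -/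
def ψfar (p : ℤ × ℤ) : ℝ := if p = 0 ∨ p ∈ NN6 then 0 else ψQ (Qf p)

/-- Nearest neighbours have norm form `1`. [folklore] -/
theorem Qf_of_mem_NN6 {p : ℤ × ℤ} (hp : p ∈ NN6) : Qf p = 1 := by
  simp only [NN6, Finset.mem_insert, Finset.mem_singleton] at hp
  rcases hp with rfl | rfl | rfl | rfl | rfl | rfl <;> simp [Qf]

/-- The origin is not a nearest neighbour. [folklore] -/
theorem zero_not_mem_NN6 : (0 : ℤ × ℤ) ∉ NN6 := by decide

/-- `NN6` has six elements. [folklore] -/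
theorem card_NN6 : NN6.card = 6 := by decide

/-- Row = nearest-neighbour part + far part. [folklore] -/
theorem ψpl_eq_add (p : ℤ × ℤ) : ψpl p = ψNN p + ψfar p := by
  unfold ψpl ψNN ψfar
  by_cases h0 : p = 0
  · subst h0; simp [zero_not_mem_NN6]
  · by_cases hN : p ∈ NN6
    · simp [h0, hN, Qf_of_mem_NN6 hN]
    · simp [h0, hN]

/-- Beyond the nearest neighbours the norm form is `≥ 3` (there is no `η` with `|η|² = 2a²`).
[folklore] -/
theorem three_le_Qf {p : ℤ × ℤ} (h0 : p ≠ 0) (hN : p ∉ NN6) : 3 ≤ Qf p := by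
  obtain ⟨i, j⟩ := p
  by_contra hlt
  push Not at hlt
  simp only [Qf] at hlt
  have hj : j ≤ 1 := by nlinarith [sq_nonneg (2 * i + j)]
  have hj' : -1 ≤ j := by nlinarith [sq_nonneg (2 * i + j)]
  have hi : i ≤ 1 := by nlinarith [sq_nonneg (i + 2 * j)]
  have hi' : -1 ≤ i := by nlinarith [sq_nonneg (i + 2 * j)]
  interval_cases i <;> interval_cases j <;> simp_all [NN6]

/-- `4q ≥ 3i²`. [folklore] -/
theorem sq_fst_le_Qf (p : ℤ × ℤ) : 3 * (p.1 : ℝ) ^ 2 ≤ 4 * (Qf p : ℝ) := by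
  simp only [Qf]; push_cast; nlinarith [sq_nonneg ((p.1 : ℝ) + 2 * p.2)]

/-- `4q ≥ 3j²`. [folklore] -/
theorem sq_snd_le_Qf (p : ℤ × ℤ) : 3 * (p.2 : ℝ) ^ 2 ≤ 4 * (Qf p : ℝ) := by
  simp only [Qf]; push_cast; nlinarith [sq_nonneg (2 * (p.1 : ℝ) + p.2)]

/-- The strip bound: `q⁻⁴ ≤ (256/81)·t(i)·φ(j)` for `|i| ≥ 3`, `4q ≥ 3i²`, `4q ≥ 3j²`
(and `q = i²` if `j = 0`). [folklore] -/
theorem inv_pow_four_le_strip {i j : ℤ} {q : ℝ} (hi : 3 ≤ |i|) (hqi : 3 * (i : ℝ) ^ 2 ≤ 4 * q)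
    (hqj : 3 * (j : ℝ) ^ 2 ≤ 4 * q) (hq0 : j = 0 → q = (i : ℝ) ^ 2) :
    (q ^ 4)⁻¹ ≤ 256 / 81 * (t4 i * φ4 j) := by
  have hi9 : (9 : ℝ) ≤ (i : ℝ) ^ 2 := by
    have h : (9 : ℤ) ≤ i ^ 2 := by nlinarith [abs_nonneg i, sq_abs i]
    exact_mod_cast h
  have ht : t4 i = ((i : ℝ) ^ 4)⁻¹ := if_pos hi
  rw [ht]
  by_cases hj : j = 0
  · have hφ : φ4 j = 1 := if_pos hj
    rw [hq0 hj, hφ, mul_one]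
    have hi4 : (1 : ℝ) ≤ (i : ℝ) ^ 4 := by nlinarith
    have hpos : (0 : ℝ) < (i : ℝ) ^ 4 := by linarith
    rw [show ((i : ℝ) ^ 2) ^ 4 = (i : ℝ) ^ 4 * (i : ℝ) ^ 4 by ring, mul_inv]
    have hle1 : ((i : ℝ) ^ 4)⁻¹ ≤ 1 := inv_le_one_of_one_le₀ hi4
    have h0 : (0 : ℝ) ≤ ((i : ℝ) ^ 4)⁻¹ := by positivity
    nlinarith
  · have hφ : φ4 j = ((j : ℝ) ^ 4)⁻¹ := if_neg hj
    rw [hφ]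
    have hj1 : (1 : ℝ) ≤ (j : ℝ) ^ 2 := by
      have h : (1 : ℤ) ≤ j ^ 2 := by nlinarith [Int.one_le_abs hj, sq_abs j]
      exact_mod_cast h
    have hq : 0 < q := by nlinarith
    have h1 : 9 * ((i : ℝ) ^ 2 * (j : ℝ) ^ 2) ≤ 16 * q ^ 2 := by nlinarith
    have hmain : 81 / 256 * ((i : ℝ) ^ 4 * (j : ℝ) ^ 4) ≤ q ^ 4 := by
      have h9 : (0 : ℝ) ≤ 9 * ((i : ℝ) ^ 2 * (j : ℝ) ^ 2) := by positivity
      have h2 := mul_le_mul h1 h1 h9 (by positivity)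
      nlinarith [h2]
    have hi4 : (0 : ℝ) < (i : ℝ) ^ 4 := by nlinarith [hi9]
    have hj4 : (0 : ℝ) < (j : ℝ) ^ 4 := by nlinarith [hj1]
    have hpos : (0 : ℝ) < 81 / 256 * ((i : ℝ) ^ 4 * (j : ℝ) ^ 4) :=
      mul_pos (by norm_num) (mul_pos hi4 hj4)
    calc (q ^ 4)⁻¹ ≤ (81 / 256 * ((i : ℝ) ^ 4 * (j : ℝ) ^ 4))⁻¹ := inv_anti₀ hpos hmain
      _ = 256 / 81 * (((i : ℝ) ^ 4)⁻¹ * ((j : ℝ) ^ 4)⁻¹) := by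
          rw [mul_inv, mul_inv, inv_div]

/-- `a₀⁻⁸`. [folklore] -/
def C₀ : ℝ := ((a₀ ^ 2)⁻¹) ^ 4

/-- For `q ≥ 3`: `0 ≤ ψ(q) ≤ a₀⁻⁸ q⁻⁴`. [folklore] -/
theorem ψQ_bounds {q : ℝ} (hq : 3 ≤ q) : 0 ≤ ψQ q ∧ ψQ q ≤ C₀ * (q ^ 4)⁻¹ := by
  unfold ψQ C₀ a₀
  set x : ℝ := (((47 / 50 : ℝ)) ^ 2 * q)⁻¹ with hx
  have hx0 : 0 ≤ x := by positivity
  have hx1 : x ≤ 1 := by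
    rw [hx]; exact inv_le_one_of_one_le₀ (by nlinarith)
  have h74 : x ^ 7 ≤ x ^ 4 := pow_le_pow_of_le_one hx0 hx1 (by norm_num)
  refine ⟨by linarith, ?_⟩
  have hx4 : x ^ 4 = ((47 / 50 : ℝ) ^ 2)⁻¹ ^ 4 * (q ^ 4)⁻¹ := by
    rw [hx, mul_inv, mul_pow, inv_pow q]
  have h7 : 0 ≤ x ^ 7 := by positivity
  linarith

/-- The `5 × 5` block of labels around the origin. [folklore] -/
def block : Finset (ℤ × ℤ) := Finset.Icc (-2 : ℤ) 2 ×ˢ Finset.Icc (-2 : ℤ) 2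

/-- `#block = 25`. [folklore] -/
theorem card_block : block.card = 25 := by
  rw [block, Finset.card_product, Int.card_Icc]; rfl

/-- The majorant of the far part: `a₀⁻⁸/81` on the block plus the two strips. [folklore] -/
def Bmaj (p : ℤ × ℤ) : ℝ :=
  (if p ∈ block then C₀ / 81 else 0) + 256 / 81 * C₀ * (t4 p.1 * φ4 p.2) +
    256 / 81 * C₀ * (φ4 p.1 * t4 p.2)

/-- `ψfar ≥ 0`: beyond the nearest neighbours `r² = a₀²q ≥ 3a₀² > 1`, where the transverse
weight `−r⁻¹⁴ + r⁻⁸` is positive. [folklore] -/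
theorem ψfar_nonneg (p : ℤ × ℤ) : 0 ≤ ψfar p := by
  unfold ψfar
  by_cases h : p = 0 ∨ p ∈ NN6
  · rw [if_pos h]
  · rw [if_neg h]
    push Not at h
    have hq : (3 : ℝ) ≤ (Qf p : ℝ) := by exact_mod_cast three_le_Qf h.1 h.2
    exact (ψQ_bounds hq).1

/-- The three parts of the majorant are `≥ 0`. [folklore] -/
theorem Bmaj_parts_nonneg (p : ℤ × ℤ) :
    0 ≤ (if p ∈ block then C₀ / 81 else 0) ∧ 0 ≤ 256 / 81 * C₀ * (t4 p.1 * φ4 p.2) ∧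
      0 ≤ 256 / 81 * C₀ * (φ4 p.1 * t4 p.2) := by
  have hC : 0 ≤ C₀ := by unfold C₀; positivity
  refine ⟨?_, ?_, ?_⟩
  · split_ifs
    · exact div_nonneg hC (by norm_num)
    · exact le_rfl
  · exact mul_nonneg (mul_nonneg (by norm_num) hC) (mul_nonneg (t4_nonneg _) (φ4_nonneg _))
  · exact mul_nonneg (mul_nonneg (by norm_num) hC) (mul_nonneg (φ4_nonneg _) (t4_nonneg _))

/-- `ψfar ≤ Bmaj` termwise. [folklore] -/
theorem ψfar_le_Bmaj (p : ℤ × ℤ) : ψfar p ≤ Bmaj p := by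
  obtain ⟨hB1, hB2, hB3⟩ := Bmaj_parts_nonneg p
  have hC : 0 ≤ C₀ := by unfold C₀; positivity
  have hBdef : Bmaj p = (if p ∈ block then C₀ / 81 else 0) + 256 / 81 * C₀ * (t4 p.1 * φ4 p.2) +
      256 / 81 * C₀ * (φ4 p.1 * t4 p.2) := rfl
  rw [hBdef]
  unfold ψfar
  by_cases h : p = 0 ∨ p ∈ NN6
  · rw [if_pos h]; linarith
  rw [if_neg h]
  push Not at h
  have hq3 : (3 : ℝ) ≤ (Qf p : ℝ) := by exact_mod_cast three_le_Qf h.1 h.2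
  have hle := (ψQ_bounds hq3).2
  by_cases hb : p ∈ block
  · -- inside the block, beyond the nearest neighbours: `q ≥ 3`
    rw [if_pos hb] at hB1 ⊢
    have hq2 : (9 : ℝ) ≤ (Qf p : ℝ) ^ 2 := by nlinarith
    have hq4 : (81 : ℝ) ≤ (Qf p : ℝ) ^ 4 := by nlinarith [hq2]
    have : C₀ * ((Qf p : ℝ) ^ 4)⁻¹ ≤ C₀ / 81 := by
      rw [div_eq_mul_inv]
      exact mul_le_mul_of_nonneg_left (inv_anti₀ (by norm_num) hq4) hC
    linarith
  · -- outside the block: one of the two strips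
    rw [if_neg hb] at hB1 ⊢
    have hout : 3 ≤ |p.1| ∨ 3 ≤ |p.2| := by
      simp only [block, Finset.mem_product, Finset.mem_Icc, not_and_or, not_le] at hb
      rw [le_abs, le_abs]
      omega
    rcases hout with hi | hj
    · have hs := inv_pow_four_le_strip hi (sq_fst_le_Qf p) (sq_snd_le_Qf p) (fun hj => by
        simp only [Qf, hj]; push_cast; ring)
      have := mul_le_mul_of_nonneg_left hs hC
      nlinarith
    · have hs := inv_pow_four_le_strip (q := (Qf p : ℝ)) hj (sq_snd_le_Qf p) (sq_fst_le_Qf p)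
        (fun hi => by simp only [Qf, hi]; push_cast; ring)
      have := mul_le_mul_of_nonneg_left hs hC
      nlinarith [mul_comm (t4 p.2) (φ4 p.1)]

/-- The block part of the majorant sums to `25·a₀⁻⁸/81`. [folklore] -/
theorem hasSum_block : HasSum (fun p : ℤ × ℤ => if p ∈ block then C₀ / 81 else 0) (25 * (C₀ / 81)) := by
  have h : HasSum (fun p : ℤ × ℤ => if p ∈ block then C₀ / 81 else 0)
      (∑ p ∈ block, if p ∈ block then C₀ / 81 else 0) :=
    hasSum_sum_of_ne_finset_zero fun p hp => if_neg hp
  convert h using 1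
  rw [Finset.sum_congr rfl (fun p hp => (if_pos hp : (if p ∈ block then C₀ / 81 else 0) = C₀ / 81)),
    Finset.sum_const, card_block, nsmul_eq_mul]
  norm_num

/-- The majorant is summable with the explicit sum. [folklore] -/
theorem hasSum_Bmaj : HasSum Bmaj (25 * (C₀ / 81) +
    256 / 81 * C₀ * ((∑' n, t4 n) * ∑' n, φ4 n) + 256 / 81 * C₀ * ((∑' n, φ4 n) * ∑' n, t4 n)) := by
  have h1 : HasSum (fun p : ℤ × ℤ => t4 p.1 * φ4 p.2) ((∑' n, t4 n) * ∑' n, φ4 n) := by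
    rw [tsum_mul_tsum_of_summable_norm summable_norm_t4 summable_norm_φ4]
    exact (summable_mul_of_summable_norm summable_norm_t4 summable_norm_φ4).hasSum
  have h2 : HasSum (fun p : ℤ × ℤ => φ4 p.1 * t4 p.2) ((∑' n, φ4 n) * ∑' n, t4 n) := by
    rw [tsum_mul_tsum_of_summable_norm summable_norm_φ4 summable_norm_t4]
    exact (summable_mul_of_summable_norm summable_norm_φ4 summable_norm_t4).hasSum
  exact (hasSum_block.add (h1.mul_left _)).add (h2.mul_left _)

/-- `ψfar` is summable. [folklore] -/
theorem summable_ψfar : Summable ψfar :=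
  Summable.of_nonneg_of_le ψfar_nonneg ψfar_le_Bmaj hasSum_Bmaj.summable

/-- The far part is at most `2.597`. [folklore] -/
theorem tsum_ψfar_le :
    ∑' p, ψfar p ≤ 25 * (C₀ / 81) + 2 * (256 / 81 * C₀ * (63 / 1000 * (16 / 5))) := by
  have ht := tsum_t4_le
  have hφ := tsum_φ4_le
  have ht0 : 0 ≤ ∑' n, t4 n := tsum_nonneg t4_nonneg
  have hφ0 : 0 ≤ ∑' n, φ4 n := tsum_nonneg φ4_nonneg
  have hprod : (∑' n, t4 n) * (∑' n, φ4 n) ≤ 63 / 1000 * (16 / 5) :=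
    mul_le_mul ht hφ hφ0 (by norm_num)
  have hC : 0 ≤ C₀ := by unfold C₀; positivity
  calc ∑' p, ψfar p ≤ ∑' p, Bmaj p :=
        Summable.tsum_le_tsum ψfar_le_Bmaj summable_ψfar hasSum_Bmaj.summable
    _ = _ := hasSum_Bmaj.tsum_eq
    _ ≤ _ := by nlinarith [mul_comm (∑' n, t4 n) (∑' n, φ4 n)]

/-- The nearest-neighbour part sums to `6ψ(1)`. [folklore] -/
theorem hasSum_ψNN : HasSum ψNN (6 * ψQ 1) := by
  have h : HasSum ψNN (∑ p ∈ NN6, ψNN p) :=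
    hasSum_sum_of_ne_finset_zero fun p hp => if_neg hp
  convert h using 1
  unfold ψNN
  rw [Finset.sum_congr rfl (fun p hp => (if_pos hp : (if p ∈ NN6 then ψQ 1 else 0) = ψQ 1)),
    Finset.sum_const, card_NN6, nsmul_eq_mul]
  norm_num

/-- The planar row function is summable. [folklore] -/
theorem summable_ψpl : Summable ψpl := by
  rw [show ψpl = fun p => ψNN p + ψfar p from funext ψpl_eq_add]
  exact hasSum_ψNN.summable.add summable_ψfar

/-- **The compressed triangular LJ membrane buckles:** at spacing `a₀ = 47/50` the transverse
single-site stiffness `P = Σ_{η∈Λ∖0} V′(|η|)/|η|` of one layer is `< −3/2` (numerically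
`−4.261 = 6·(−0.7375) + 0.164`). [folklore] -/
theorem tsum_ψpl_lt : ∑' p, ψpl p < -3 / 2 := by
  have h1 : ∑' p, ψpl p = 6 * ψQ 1 + ∑' p, ψfar p := by
    rw [show ψpl = fun p => ψNN p + ψfar p from funext ψpl_eq_add,
      hasSum_ψNN.summable.tsum_add summable_ψfar, hasSum_ψNN.tsum_eq]
  rw [h1]
  have h2 := tsum_ψfar_le
  have hv : 6 * ψQ 1 + (25 * (C₀ / 81) + 2 * (256 / 81 * C₀ * (63 / 1000 * (16 / 5)))) < -3 / 2 := by
    unfold ψQ C₀ a₀; norm_num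
  linarith

end Summit.AtomisticToContinuum.Crystallization.Theorems.UniformPolytypeStabilityNegative

end
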